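/-
Copyright (c) 2026 the pub-hodgecm-mathlib formalisation cell (harness21).  Prover seat hodgecm-mathlib-R90-C131-p02 (g2) on the S4 valve (dealer K2E2-plan (g8), S4-R59 (4) ∕
S4-R63), road (J̃♭) FILE (TJ6) «HERBRAND WINDOW», part 1 of 3: THE INDEX IDENTITY OF AN INVOLUTION ON AN ABELIAN GROUP (pure group theory, Mathlib only).
Crux H413 `stmt-HodgeConjecture-24833`, lane `--supports … --as helper` (count-neutral).  THEOREMS ONLY (no `def`, no `instance`, no notation, no named-fact hypothesis, no `sorry`).
-/
import Mathlib.GroupTheory.Index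
import HarnessLib

/-!
# R90-TF · S4 (Ch. 13.1–2) · road (J̃♭) «TWISTED TUBE JACOBIAN», FILE (TJ6) «HERBRAND WINDOW», part 1: THE INVOLUTION INDEX IDENTITY

Cell `hodgecm-mathlib`, crux H413 (`stmt-HodgeConjecture-24833`, lane `--supports … --as helper`), route of record `HCCMUnconditional` (no route verbs;
count-neutral).  Programme R90-TF, section S4 = [Rogawski1990] Ch. 13.1–13.2 (twisted Weyl integration formula, §12.5 p. 186); seat R90-C131-p02 (g2);
ORDER = S4 dealer K2E2-plan (g8) S4-R59 (4) «(TJ6) HERBRAND WINDOW» with the spec of record S4-R63 = K2E3-p03 (g10)'s (TJ5-abs) binder `h♮`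
(`Theorems/R90S4TwistedTubeJacobianCore.lean :: twistedTubeJacobian_of_local`):
`ρ(c(W_j)) · τ′(T′ ∩ W_j) = ρ(T̃ᴺ ∩ W_j) · tT(N(W_j))` — the HERBRAND QUOTIENT `h(⟨ε⟩, W_j) = 1` of the window in Haar form.

THIS FILE is the measure-free, topology-free CORE: an abelian group `B` (commutativity as a letter `hc`, no `CommGroup` instance, so that the consumer
may take `B := ↥(W j)` for a subgroup of a subgroup of a non-abelian `G`), an endomorphism `e` with `e ∘ e = id` (the twist `ε`), and the three letters
`D x = x·(e x)⁻¹` («`c`», the `(1 − ε)`-map, values in the NORM-ONE part `K := ker N = {e x = x⁻¹}`), `N x = x·(e x)` (the `(1 + ε)`-map, values in the FIXED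
part `F := ker D = {e x = x}`), `sq x = x·x`.  In this language `|Ĥ⁻¹(⟨e⟩, B)| = [K : D(B)]` and `|Ĥ⁰(⟨e⟩, B)| = [F : N(B)]` ([Serre1979, VIII §4], [Neukirch2013,
I §6 (6.2)–(6.3)]: `h = q_{D,N}`), and the file proves, with Mathlib's `Subgroup.relIndex` (value `0` for an infinite index, so that NO finiteness proviso is needed):

* §1 **`relIndex_map_sq_eq_of_relIndex_ne_zero`** (+ additive twin `relIndex_map_double_eq_of_relIndex_ne_zero`, §1b): the DOUBLING INDEX `[H : H²]` of a subgroup on which `sq` is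
  injective is invariant under passage to a finite-index over-group `H ≤ L`: `[H : H²] = [L : L²]` ([Neukirch2013, I §6 Prop. (6.7)–(6.8)]: `q_{0,2}` of a finite
  module is `1`).
* §2 the involution calculus: `D(B) ≤ K`, `N(B) ≤ F`, `D ↾ K = sq ↾ K`, `N ↾ F = sq ↾ F`, and the key set identity `D⁻¹(K²) = N⁻¹(F²)` (both are `K·F`).
* §3 **`relIndex_sq_ker_mul_relIndex_range_eq`** — THE INVOLUTION INDEX IDENTITY **`[K : K²]·[F : N(B)] = [F : F²]·[K : D(B)]`** (both sides equal
  `[B : K·F]·[K : D(B)]·[F : N(B)]`, counting `[B : D⁻¹(K²)]` through `D` and through `N`; Mathlib `Subgroup.index_comap`, `Subgroup.relIndex_mul_relIndex`),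
  i.e. `h(⟨e⟩, B) = [F : F²] ⁄ [K : K²]`; and its cancelled form **`relIndex_range_eq_of_relIndex_sq_eq`**: `[K : K²] = [F : F²] ≠ 0 ⇒ [K : D(B)] = [F : N(B)]`
  (`h = 1`).  Parts 2–3 (`R90S4CayleyWindowDoubling`, `R90S4TwistedHerbrandWindow`) supply `[K : K²] = [F : F²] ≠ 0` for the Cayley window `W_j = T̃ ∩ c(Λ_j)`
  («`dim 𝔨 = dim 𝔭`», index form) and turn indices into Haar masses.

HONEST LABEL: HC_CM is proved only modulo the 7 printed citations (2 remaining named inputs: hLiu418 = `stmt-HodgeConjecture-24832`, h413 =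
`stmt-HodgeConjecture-24833`) until rung 0 closes; this file closes no socket (REL ≠ ★ ≠ BUILT; count-neutral).

## References
* [Serre1979] J.-P. Serre, *Local Fields*, GTM 67 (1979), VIII §4 (Herbrand quotient, Props. 7–8 and Corollary). Context locator.
* [Neukirch2013] J. Neukirch, *Class Field Theory – The Bonn Lectures* (2013), Part I §6, (6.2)–(6.8). Context locator.
* [Rogawski1990] J. D. Rogawski, *Automorphic Representations of Unitary Groups in Three Variables*, Ann. of Math. Stud. 123 (1990), §12.5 p. 186. Context locator.
-/

set_option autoImplicit false
-- the mandated namespace repeats the single-problem summit's segment (`HodgeConjecture.HodgeConjecture`)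
set_option linter.dupNamespace false

namespace Summit.HodgeConjecture.HodgeConjecture.R90.S4

/-! ## §1 The doubling index is invariant under finite-index over-groups -/

section Doubling

variable {B : Type*} [Group B]

/-- A «squaring letter» `sq x = x·x` maps every subgroup into itself. [cite: Neukirch2013, I §6 (6.2)] -/
theorem map_sq_le (sq : B →* B) (hsq : ∀ x, sq x = x * x) (H : Subgroup B) : H.map sq ≤ H := by
  rintro _ ⟨h, hh, rfl⟩
  rw [hsq]
  exact H.mul_mem hh hh

/-- **THE DOUBLING INDEX IS INVARIANT UNDER FINITE-INDEX OVER-GROUPS**: if `sq x = x·x` is an injective endomorphism (no element of order `2`) and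
`H ≤ L` has finite index, then `[H : H²] = [L : L²]` — `[H² : L]` counted as `[H : H²]·[H : L]` and as `[H² : L²]·[L² : L] = [H : L]·[L : L²]`.
[cite: Neukirch2013, I §6 Prop. (6.7)–(6.8)] [cite: Serre1979, VIII §4 Cor. to Prop. 8] -/
theorem relIndex_map_sq_eq_of_relIndex_ne_zero (sq : B →* B) (hsq : ∀ x, sq x = x * x) (hinj : Function.Injective sq)
    {H L : Subgroup B} (hHL : H ≤ L) (hfin : H.relIndex L ≠ 0) :
    (H.map sq).relIndex H = (L.map sq).relIndex L := by
  have h1 : (H.map sq).relIndex H * H.relIndex L = (H.map sq).relIndex L :=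
    Subgroup.relIndex_mul_relIndex (hHK := map_sq_le sq hsq H) (hKL := hHL)
  have h2 : (H.map sq).relIndex (L.map sq) * (L.map sq).relIndex L = (H.map sq).relIndex L :=
    Subgroup.relIndex_mul_relIndex (hHK := Subgroup.map_mono hHL) (hKL := map_sq_le sq hsq L)
  rw [Subgroup.relIndex_map_map_of_injective _ _ hinj] at h2
  have h3 : (H.map sq).relIndex H * H.relIndex L = (L.map sq).relIndex L * H.relIndex L := by rw [h1, ← h2, mul_comm]
  exact mul_right_cancel₀ hfin h3

/-- In a group without elements of order `2` (`x·x = 1 ⇒ x = 1`) a squaring letter `sq` (a homomorphism, e.g. on an abelian group) is injective.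
[cite: Neukirch2013, I §6 (6.2)] -/
theorem injective_sq_of_forall_mul_self (sq : B →* B) (hsq : ∀ x, sq x = x * x) (h2 : ∀ x : B, x * x = 1 → x = 1) :
    Function.Injective sq := by
  intro x y hxy
  have h : sq (x * y⁻¹) = 1 := by rw [map_mul, map_inv, hxy, mul_inv_cancel]
  rw [hsq] at h
  exact mul_inv_eq_one.1 (h2 _ h)

end Doubling

/-! ## §1b The additive twins (for the lattices `M^± ⊆ 𝔞` of part 3) -/

section AddDoubling

variable {V : Type*} [AddGroup V]

/-- A «doubling letter» `db x = x + x` maps every additive subgroup into itself. [cite: Neukirch2013, I §6 (6.2)] -/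
theorem map_double_le (db : V →+ V) (hdb : ∀ x, db x = x + x) (H : AddSubgroup V) : H.map db ≤ H := by
  rintro _ ⟨h, hh, rfl⟩
  rw [hdb]
  exact H.add_mem hh hh

/-- **THE DOUBLING INDEX IS INVARIANT UNDER FINITE-INDEX OVER-GROUPS** (additive): if `db x = x + x` is an injective endomorphism and `H ≤ L`
has finite index, then `[H : 2H] = [L : 2L]`. [cite: Neukirch2013, I §6 Prop. (6.7)–(6.8)] [cite: Serre1979, VIII §4 Cor. to Prop. 8] -/
theorem relIndex_map_double_eq_of_relIndex_ne_zero (db : V →+ V) (hdb : ∀ x, db x = x + x) (hinj : Function.Injective db)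
    {H L : AddSubgroup V} (hHL : H ≤ L) (hfin : H.relIndex L ≠ 0) :
    (H.map db).relIndex H = (L.map db).relIndex L := by
  have h1 : (H.map db).relIndex H * H.relIndex L = (H.map db).relIndex L :=
    AddSubgroup.relIndex_mul_relIndex (hHK := map_double_le db hdb H) (hKL := hHL)
  have h2 : (H.map db).relIndex (L.map db) * (L.map db).relIndex L = (H.map db).relIndex L :=
    AddSubgroup.relIndex_mul_relIndex (hHK := AddSubgroup.map_mono hHL) (hKL := map_double_le db hdb L)
  rw [AddSubgroup.relIndex_map_map_of_injective _ _ hinj] at h2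
  have h3 : (H.map db).relIndex H * H.relIndex L = (L.map db).relIndex L * H.relIndex L := by rw [h1, ← h2, mul_comm]
  exact mul_right_cancel₀ hfin h3

/-- In an additive group without elements of order `2` (`x + x = 0 ⇒ x = 0`) an additive doubling letter is injective. [cite: Neukirch2013, I §6 (6.2)] -/
theorem injective_double_of_forall_add_self (db : V →+ V) (hdb : ∀ x, db x = x + x) (h2 : ∀ x : V, x + x = 0 → x = 0) :
    Function.Injective db := by
  intro x y hxy
  have h : db (x - y) = 0 := by rw [map_sub, hxy, sub_self]
  rw [hdb] at h
  exact sub_eq_zero.1 (h2 _ h)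

end AddDoubling

/-! ## §2 The involution calculus: `D(B) ≤ K`, `N(B) ≤ F`, `D ↾ K = N ↾ F = sq`, `D⁻¹(K²) = N⁻¹(F²)` -/

section Involution

variable {B : Type*} [Group B] (hc : ∀ x y : B, x * y = y * x) (e D N sq : B →* B)
  (he : ∀ x, e (e x) = x) (hD : ∀ x, D x = x * (e x)⁻¹) (hN : ∀ x, N x = x * e x) (hsq : ∀ x, sq x = x * x)

include hN in
/-- `x ∈ K = ker N ↔ e x = x⁻¹`. [cite: Serre1979, VIII §4] -/
theorem mem_ker_norm_iff (x : B) : x ∈ N.ker ↔ e x = x⁻¹ := by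
  rw [MonoidHom.mem_ker, hN, mul_eq_one_iff_eq_inv']

include hD in
/-- `x ∈ F = ker D ↔ e x = x`. [cite: Serre1979, VIII §4] -/
theorem mem_ker_sub_iff (x : B) : x ∈ D.ker ↔ e x = x := by
  rw [MonoidHom.mem_ker, hD, mul_inv_eq_one, eq_comm]

include hc he hD hN in
/-- `D(B) ≤ K`: `N(D x) = x (e x)⁻¹ · e x · x⁻¹ = 1`. [cite: Serre1979, VIII §4] [cite: Neukirch2013, I §6 (6.2)] -/
theorem range_sub_le_ker_norm : D.range ≤ N.ker := by
  rintro _ ⟨x, rfl⟩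
  rw [mem_ker_norm_iff e N hN, hD, map_mul, map_inv, he, mul_inv_rev, inv_inv, hc]

include hc he hD hN in
/-- `N(B) ≤ F`: `e(x · e x) = e x · x = x · e x`. [cite: Serre1979, VIII §4] [cite: Neukirch2013, I §6 (6.2)] -/
theorem range_norm_le_ker_sub : N.range ≤ D.ker := by
  rintro _ ⟨x, rfl⟩
  rw [mem_ker_sub_iff e D hD, hN, map_mul, he, hc]

include hD hN hsq in
/-- On `K` the map `D` is squaring: `e k = k⁻¹ ⇒ D k = k·k`. [cite: Neukirch2013, I §6 (6.2)] -/
theorem sub_eq_sq_of_mem_ker_norm {k : B} (hk : k ∈ N.ker) : D k = sq k := by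
  rw [hD, (mem_ker_norm_iff e N hN k).1 hk, inv_inv, hsq]

include hD hN hsq in
/-- On `F` the map `N` is squaring: `e f = f ⇒ N f = f·f`. [cite: Neukirch2013, I §6 (6.2)] -/
theorem norm_eq_sq_of_mem_ker_sub {f : B} (hf : f ∈ D.ker) : N f = sq f := by
  rw [hN, (mem_ker_sub_iff e D hD f).1 hf, hsq]

include hD hN hsq in
/-- `D(K) = K²`. [cite: Neukirch2013, I §6 (6.2)] -/
theorem map_ker_norm_sub_eq : N.ker.map D = N.ker.map sq := by
  ext y
  simp only [Subgroup.mem_map]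
  constructor
  · rintro ⟨k, hk, rfl⟩; exact ⟨k, hk, (sub_eq_sq_of_mem_ker_norm e D N sq hD hN hsq hk).symm⟩
  · rintro ⟨k, hk, rfl⟩; exact ⟨k, hk, sub_eq_sq_of_mem_ker_norm e D N sq hD hN hsq hk⟩

include hD hN hsq in
/-- `N(F) = F²`. [cite: Neukirch2013, I §6 (6.2)] -/
theorem map_ker_sub_norm_eq : D.ker.map N = D.ker.map sq := by
  ext y
  simp only [Subgroup.mem_map]
  constructor
  · rintro ⟨f, hf, rfl⟩; exact ⟨f, hf, (norm_eq_sq_of_mem_ker_sub e D N sq hD hN hsq hf).symm⟩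
  · rintro ⟨f, hf, rfl⟩; exact ⟨f, hf, norm_eq_sq_of_mem_ker_sub e D N sq hD hN hsq hf⟩

include hD hN hsq in
/-- `K² ≤ D(B)`. [cite: Neukirch2013, I §6 (6.2)] -/
theorem map_sq_ker_norm_le_range : N.ker.map sq ≤ D.range := by
  rw [← map_ker_norm_sub_eq e D N sq hD hN hsq]; exact Subgroup.map_le_range _ _

include hD hN hsq in
/-- `F² ≤ N(B)`. [cite: Neukirch2013, I §6 (6.2)] -/
theorem map_sq_ker_sub_le_range : D.ker.map sq ≤ N.range := by
  rw [← map_ker_sub_norm_eq e D N sq hD hN hsq]; exact Subgroup.map_le_range _ _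

include hc hD hN hsq in
/-- **THE KEY SET IDENTITY `D⁻¹(K²) = N⁻¹(F²)`** (both are `K·F`): if `D x = k·k` with `e k = k⁻¹` then `f := x·k⁻¹` is `e`-fixed and `N x = f·f`, and
symmetrically. [cite: Serre1979, VIII §4] [cite: Neukirch2013, I §6 (6.8)] -/
theorem comap_sub_map_sq_eq_comap_norm_map_sq : (N.ker.map sq).comap D = (D.ker.map sq).comap N := by
  ext x
  simp only [Subgroup.mem_comap, Subgroup.mem_map]
  constructor
  · rintro ⟨k, hk, hkx⟩
    have hek : e k = k⁻¹ := (mem_ker_norm_iff e N hN k).1 hk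
    rw [hsq, hD] at hkx
    -- `e x = k⁻¹ k⁻¹ x`
    have hex : e x = k⁻¹ * k⁻¹ * x := by
      have h1 : (e x)⁻¹ = x⁻¹ * (k * k) := by rw [hkx, ← mul_assoc, inv_mul_cancel, one_mul]
      have h2 := congrArg (·⁻¹) h1
      simp only [inv_inv, mul_inv_rev] at h2
      exact h2
    refine ⟨x * k⁻¹, ?_, ?_⟩
    · rw [mem_ker_sub_iff e D hD, map_mul, map_inv, hek, inv_inv, hex, hc (k⁻¹ * k⁻¹ * x) k]
      simp only [← mul_assoc, mul_inv_cancel, one_mul]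
      rw [hc]
    · rw [hsq, hN, hex]
      calc x * k⁻¹ * (x * k⁻¹) = x * (k⁻¹ * x) * k⁻¹ := by simp only [mul_assoc]
        _ = x * (x * k⁻¹) * k⁻¹ := by rw [hc k⁻¹ x]
        _ = x * (k⁻¹ * k⁻¹ * x) := by rw [hc (k⁻¹ * k⁻¹) x]; simp only [mul_assoc]
  · rintro ⟨f, hf, hfx⟩
    have hef : e f = f := (mem_ker_sub_iff e D hD f).1 hf
    rw [hsq, hN] at hfx
    -- `e x = x⁻¹ f f`
    have hex : e x = x⁻¹ * (f * f) := by rw [hfx, ← mul_assoc, inv_mul_cancel, one_mul]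
    refine ⟨x * f⁻¹, ?_, ?_⟩
    · rw [mem_ker_norm_iff e N hN, map_mul, map_inv, hef, hex, mul_inv_rev, inv_inv]
      calc x⁻¹ * (f * f) * f⁻¹ = x⁻¹ * f := by simp only [mul_assoc, mul_inv_cancel, mul_one]
        _ = f * x⁻¹ := hc _ _
    · rw [hsq, hD, hex, mul_inv_rev, inv_inv]
      calc x * f⁻¹ * (x * f⁻¹) = x * (f⁻¹ * x) * f⁻¹ := by simp only [mul_assoc]
        _ = x * (x * f⁻¹) * f⁻¹ := by rw [hc f⁻¹ x]
        _ = x * ((f * f)⁻¹ * x) := by rw [hc (f * f)⁻¹ x, mul_inv_rev]; simp only [mul_assoc]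

end Involution

/-! ## §3 The involution index identity `[K : K²]·[F : N(B)] = [F : F²]·[K : D(B)]` and its cancelled form -/

section Identity

variable {B : Type*} [Group B] (hc : ∀ x y : B, x * y = y * x) (e D N sq : B →* B)
  (he : ∀ x, e (e x) = x) (hD : ∀ x, D x = x * (e x)⁻¹) (hN : ∀ x, N x = x * e x) (hsq : ∀ x, sq x = x * x)

include hc he hD hN hsq in
/-- **THE INVOLUTION INDEX IDENTITY** (unconditional in `ℕ`, Mathlib's convention `0` for an infinite index): for an abelian group `B` with an
endomorphism `e`, `e ∘ e = id`, `K = ker N = {e x = x⁻¹}`, `F = ker D = {e x = x}`: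
**`[K : K²]·[F : N(B)] = [F : F²]·[K : D(B)]`** — both sides are `[B : D⁻¹(K²)]·[K : D(B)]·[F : N(B)]`, since `[K : K²] = [K : D(B)]·[D(B) : K²]`,
`[D(B) : K²] = [B : D⁻¹(K²)]`, `D⁻¹(K²) = N⁻¹(F²)` and symmetrically.  In Herbrand's language `h(⟨e⟩, B) = |Ĥ⁰|⁄|Ĥ⁻¹| = [F : F²]⁄[K : K²]` when defined.
[cite: Serre1979, VIII §4 Props. 7–8] [cite: Neukirch2013, I §6 (6.3), (6.8)] -/
theorem relIndex_sq_ker_mul_relIndex_range_eq :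
    (N.ker.map sq).relIndex N.ker * N.range.relIndex D.ker = (D.ker.map sq).relIndex D.ker * D.range.relIndex N.ker := by
  have hK : (N.ker.map sq).relIndex N.ker = ((N.ker.map sq).comap D).index * D.range.relIndex N.ker := by
    rw [Subgroup.index_comap, Subgroup.relIndex_mul_relIndex (hHK := map_sq_ker_norm_le_range e D N sq hD hN hsq)
      (hKL := range_sub_le_ker_norm hc e D N he hD hN)]
  have hF : (D.ker.map sq).relIndex D.ker = ((D.ker.map sq).comap N).index * N.range.relIndex D.ker := by
    rw [Subgroup.index_comap, Subgroup.relIndex_mul_relIndex (hHK := map_sq_ker_sub_le_range e D N sq hD hN hsq)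
      (hKL := range_norm_le_ker_sub hc e D N he hD hN)]
  rw [hK, hF, comap_sub_map_sq_eq_comap_norm_map_sq hc e D N sq hD hN hsq, mul_right_comm]

include hc he hD hN hsq in
/-- **THE CANCELLED FORM («`h(⟨e⟩, B) = 1`»)**: if the doubling indices of the norm-one part and of the fixed part agree and are finite,
`[K : K²] = [F : F²] ≠ 0`, then **`[K : D(B)] = [F : N(B)]`**, i.e. `|Ĥ⁻¹(⟨e⟩, B)| = |Ĥ⁰(⟨e⟩, B)|`.
[cite: Serre1979, VIII §4 Props. 7–8] [cite: Neukirch2013, I §6 (6.3), (6.8)] -/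
theorem relIndex_range_eq_of_relIndex_sq_eq (hKF : (N.ker.map sq).relIndex N.ker = (D.ker.map sq).relIndex D.ker)
    (h0 : (N.ker.map sq).relIndex N.ker ≠ 0) : D.range.relIndex N.ker = N.range.relIndex D.ker := by
  have h := relIndex_sq_ker_mul_relIndex_range_eq hc e D N sq he hD hN hsq
  rw [← hKF] at h
  exact (mul_left_cancel₀ h0 h).symm

end Identity

end Summit.HodgeConjecture.HodgeConjecture.R90.S4
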